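import Literature.NumberTheory.Transcendental.KZLogCalculusProofs
import Literature.NumberTheory.Transcendental.KZProductIdeal
import Literature.NumberTheory.Transcendental.KZDominatedFamily
import Literature.NumberTheory.Transcendental.KZMellinFibres
import Literature.NumberTheory.Transcendental.SemialgebraicLineDeriv
import Literature.NumberTheory.Transcendental.BoxIntegralZetaValues
import Summits.KontsevichZagierPeriods.KontsevichZagierPeriods.Theorems.HurwitzMicroSectorsHurwitzSectorComplementStubLadderEngineKit

/-!
# Ladder engine: bases, parameter blocks, bands — the semialgebraic layer (crux `HurwitzSectorComplement`,
# line `chebyshev-level-deformation`, stub S1 `stub_ladderEngine`)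

The ladder engine works over a BASE `box^n × D ⊆ ℝⁿ⁺ᵏ` (first `n` coordinates in the open unit box,
last `k` — the parameter block `y` — in a bounded `ℚ`-semialgebraic `D ⊆ ℝᵏ`), with a semialgebraic
weight `W(y)` and a semialgebraic deformation parameter `lam(y) > 0`; a step appends the new parameter
`y₀ ∈ (0, lam y)` as a Newton–Leibniz band variable and then moves it to the FRONT of the parameter
block (`D⁺ = {y′ | tail y′ ∈ D, 0 < y′₀ < lam(tail y′)}`). This file supplies the semialgebraicity
of all sets and functions involved (no definitions; everything inlined):

* `isSemialgebraic_base`, `isSemialgebraicFunOn_param_base` — the base and functions of its `y`-block;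
* `isSemialgebraic_succParam`, `isSemialgebraicFunOn_comp_tail_succParam`, `isBounded_succParam` — the
  advanced parameter block `D⁺` (and its boundedness);
* `isSemialgebraic_openBand`, `isSemialgebraicFunOn_param_initBand` — the open band over the base;
* `IsSemialgebraicFunOn.fun_div'` and the rational Chebyshev kernels `T`, `U`, `∂ᵥT`, `∂ᵥU`,
  `1/(1−s)` as semialgebraic functions of two semialgebraic arguments `t`, `s`
  (`isSemialgebraicFunOn_kernelT`, `…_kernelU`, `…_derivKernelT`, `…_derivKernelU`, `…_invOneSub`).

References: Bochnak–Coste–Roy, *Real Algebraic Geometry* (1998), §2.2; Kontsevich–Zagier, *Periods*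
(2001), §1.2.
-/

noncomputable section

open Set MeasureTheory
open Literature.NumberTheory.Transcendental
open Literature.ModelTheory.ExponentialFields (IsSemialgebraic)

namespace Summit.KontsevichZagierPeriods.Theorems.HurwitzMicroSectorsHurwitzSectorComplement.LadderEngine

/-! ## Division (junk-value form) -/

/-- The pointwise quotient of two real `ℚ`-semialgebraic functions is semialgebraic (Mathlib's junk
value `x/0 = 0` included). [cite: BochnakCosteRoy1998, Prop. 2.2.6] -/
theorem _root_.Literature.NumberTheory.Transcendental.IsSemialgebraicFunOn.fun_div' {d : ℕ}
    {S : Set (Fin d → ℝ)} {f g : (Fin d → ℝ) → ℝ} (hf : IsSemialgebraicFunOn ℚ S f)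
    (hg : IsSemialgebraicFunOn ℚ S g) : IsSemialgebraicFunOn ℚ S fun x => f x / g x :=
  (hf.fun_mul hg.fun_inv).congr fun x _ => by simp [div_eq_mul_inv]

/-! ## The rational Chebyshev kernels of two semialgebraic arguments -/

section Kernels

variable {d : ℕ} {S : Set (Fin d → ℝ)} {t s : (Fin d → ℝ) → ℝ}

/-- `den(t,s) = (1−s)² + t²(1+s)²` is semialgebraic. [cite: BochnakCosteRoy1998, Prop. 2.2.6] -/
theorem isSemialgebraicFunOn_den (hS : IsSemialgebraic ℚ S) (ht : IsSemialgebraicFunOn ℚ S t)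
    (hs : IsSemialgebraicFunOn ℚ S s) :
    IsSemialgebraicFunOn ℚ S fun z => (1 - s z) ^ 2 + (t z) ^ 2 * (1 + s z) ^ 2 := by
  have h1 := isSemialgebraicFunOn_const_natCast hS 1
  simp only [Nat.cast_one] at h1
  exact ((h1.fun_sub hs).fun_pow 2).fun_add ((ht.fun_pow 2).fun_mul ((h1.fun_add hs).fun_pow 2))

/-- The T-kernel `((1−s) − t²(1+s))/den(t,s)` is semialgebraic. [cite: BochnakCosteRoy1998, Prop. 2.2.6] -/
theorem isSemialgebraicFunOn_kernelT (hS : IsSemialgebraic ℚ S) (ht : IsSemialgebraicFunOn ℚ S t)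
    (hs : IsSemialgebraicFunOn ℚ S s) :
    IsSemialgebraicFunOn ℚ S fun z =>
      ((1 - s z) - (t z) ^ 2 * (1 + s z)) / ((1 - s z) ^ 2 + (t z) ^ 2 * (1 + s z) ^ 2) := by
  have h1 := isSemialgebraicFunOn_const_natCast hS 1
  simp only [Nat.cast_one] at h1
  exact ((h1.fun_sub hs).fun_sub ((ht.fun_pow 2).fun_mul (h1.fun_add hs))).fun_div'
    (isSemialgebraicFunOn_den hS ht hs)

/-- The U-kernel `2t/den(t,s)` is semialgebraic. [cite: BochnakCosteRoy1998, Prop. 2.2.6] -/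
theorem isSemialgebraicFunOn_kernelU (hS : IsSemialgebraic ℚ S) (ht : IsSemialgebraicFunOn ℚ S t)
    (hs : IsSemialgebraicFunOn ℚ S s) :
    IsSemialgebraicFunOn ℚ S fun z => 2 * t z / ((1 - s z) ^ 2 + (t z) ^ 2 * (1 + s z) ^ 2) :=
  ((isSemialgebraicFunOn_const_ofNat hS 2).fun_mul ht).fun_div' (isSemialgebraicFunOn_den hS ht hs)

/-- `∂ᵥT = −4t(1−s²)/den²` is semialgebraic. [cite: BochnakCosteRoy1998, Prop. 2.2.6] -/
theorem isSemialgebraicFunOn_derivKernelT (hS : IsSemialgebraic ℚ S) (ht : IsSemialgebraicFunOn ℚ S t)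
    (hs : IsSemialgebraicFunOn ℚ S s) :
    IsSemialgebraicFunOn ℚ S fun z =>
      -(4 * t z * (1 - (s z) ^ 2)) / ((1 - s z) ^ 2 + (t z) ^ 2 * (1 + s z) ^ 2) ^ 2 := by
  have h1 := isSemialgebraicFunOn_const_natCast hS 1
  simp only [Nat.cast_one] at h1
  exact ((((isSemialgebraicFunOn_const_ofNat hS 4).fun_mul ht).fun_mul
    (h1.fun_sub (hs.fun_pow 2))).fun_neg).fun_div' ((isSemialgebraicFunOn_den hS ht hs).fun_pow 2)

/-- `∂ᵥU = 2((1−s)² − t²(1+s)²)/den²` is semialgebraic. [cite: BochnakCosteRoy1998, Prop. 2.2.6] -/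
theorem isSemialgebraicFunOn_derivKernelU (hS : IsSemialgebraic ℚ S) (ht : IsSemialgebraicFunOn ℚ S t)
    (hs : IsSemialgebraicFunOn ℚ S s) :
    IsSemialgebraicFunOn ℚ S fun z =>
      2 * ((1 - s z) ^ 2 - (t z) ^ 2 * (1 + s z) ^ 2) / ((1 - s z) ^ 2 + (t z) ^ 2 * (1 + s z) ^ 2) ^ 2 := by
  have h1 := isSemialgebraicFunOn_const_natCast hS 1
  simp only [Nat.cast_one] at h1
  exact ((isSemialgebraicFunOn_const_ofNat hS 2).fun_mul
    (((h1.fun_sub hs).fun_pow 2).fun_sub ((ht.fun_pow 2).fun_mul ((h1.fun_add hs).fun_pow 2)))).fun_div'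
      ((isSemialgebraicFunOn_den hS ht hs).fun_pow 2)

/-- `1/(1−s)` is semialgebraic. [cite: BochnakCosteRoy1998, Prop. 2.2.6] -/
theorem isSemialgebraicFunOn_invOneSub (hS : IsSemialgebraic ℚ S) (hs : IsSemialgebraicFunOn ℚ S s) :
    IsSemialgebraicFunOn ℚ S fun z => 1 / (1 - s z) := by
  have h1 := isSemialgebraicFunOn_const_natCast hS 1
  simp only [Nat.cast_one] at h1
  exact h1.fun_div' (h1.fun_sub hs)

/-- `x ↦ x · K` for semialgebraic `x`, `K`. [cite: BochnakCosteRoy1998, Prop. 2.2.6] -/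
theorem isSemialgebraicFunOn_mul' {x K : (Fin d → ℝ) → ℝ} (hx : IsSemialgebraicFunOn ℚ S x)
    (hK : IsSemialgebraicFunOn ℚ S K) : IsSemialgebraicFunOn ℚ S fun z => x z * K z :=
  hx.fun_mul hK

end Kernels

/-! ## The base `box^n × D` -/

section Base

variable {n k : ℕ} {D : Set (Fin k → ℝ)} {F : (Fin k → ℝ) → ℝ}

/-- The base `{z | x-part ∈ (0,1)ⁿ ∧ y-part ∈ D}` is `ℚ`-semialgebraic. [cite: BochnakCosteRoy1998, §2.2] -/
theorem isSemialgebraic_base (hD : IsSemialgebraic ℚ D) :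
    IsSemialgebraic ℚ {z : Fin (n + k) → ℝ | (∀ i : Fin n, z (Fin.castAdd k i) ∈ Ioo (0:ℝ) 1) ∧
      (fun j : Fin k => z (Fin.natAdd n j)) ∈ D} :=
  KZ.isSemialgebraic_cylinder (KZ.isSemialgebraic_box n) hD

/-- A semialgebraic function of the parameter block, read on the base. [cite: BochnakCosteRoy1998, §2.2] -/
theorem isSemialgebraicFunOn_param_base (hD : IsSemialgebraic ℚ D) (hF : IsSemialgebraicFunOn ℚ D F) :
    IsSemialgebraicFunOn ℚ {z : Fin (n + k) → ℝ | (∀ i : Fin n, z (Fin.castAdd k i) ∈ Ioo (0:ℝ) 1) ∧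
      (fun j : Fin k => z (Fin.natAdd n j)) ∈ D} (fun z => F fun j : Fin k => z (Fin.natAdd n j)) :=
  KZ.isSemialgebraicFunOn_cylinder_right (KZ.isSemialgebraic_box n) hD hF

/-- The product of the box coordinates is semialgebraic on the base. [cite: BochnakCosteRoy1998, §2.2] -/
theorem isSemialgebraicFunOn_prod_base (hD : IsSemialgebraic ℚ D) :
    IsSemialgebraicFunOn ℚ {z : Fin (n + k) → ℝ | (∀ i : Fin n, z (Fin.castAdd k i) ∈ Ioo (0:ℝ) 1) ∧
      (fun j : Fin k => z (Fin.natAdd n j)) ∈ D} (fun z => ∏ i : Fin n, z (Fin.castAdd k i)) :=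
  IsSemialgebraicFunOn.fun_finsetProd _ (isSemialgebraic_base hD) fun i _ =>
    isSemialgebraicFunOn_apply (isSemialgebraic_base hD) (Fin.castAdd k i)

/-- On the base the product of the box coordinates lies in `(0,1)` (for `n ≠ 0`). [folklore] -/
theorem prod_base_mem_Ioo (hn : n ≠ 0) {z : Fin (n + k) → ℝ}
    (hz : ∀ i : Fin n, z (Fin.castAdd k i) ∈ Ioo (0:ℝ) 1) :
    (∏ i : Fin n, z (Fin.castAdd k i)) ∈ Ioo (0:ℝ) 1 :=
  BoxIntegral.prod_mem_Ioo hn (x := fun i => z (Fin.castAdd k i)) hz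

end Base

/-! ## The advanced parameter block `D⁺` -/

section SuccParam

variable {k : ℕ} {D : Set (Fin k → ℝ)} {F lam : (Fin k → ℝ) → ℝ}

/-- `D⁺ = {y′ : ℝᵏ⁺¹ | tail y′ ∈ D ∧ 0 < y′₀ < lam (tail y′)}` is `ℚ`-semialgebraic.
[cite: BochnakCosteRoy1998, §2.2] -/
theorem isSemialgebraic_succParam (hD : IsSemialgebraic ℚ D) (hlam : IsSemialgebraicFunOn ℚ D lam) :
    IsSemialgebraic ℚ {y' : Fin (k + 1) → ℝ | (fun j : Fin k => y' j.succ) ∈ D ∧ 0 < y' 0 ∧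
      y' 0 < lam (fun j : Fin k => y' j.succ)} := by
  have hT : IsSemialgebraic ℚ {y' : Fin (k + 1) → ℝ | (fun j : Fin k => y' j.succ) ∈ D} :=
    hD.preimage_comp Fin.succ
  have hlamT : IsSemialgebraicFunOn ℚ {y' : Fin (k + 1) → ℝ | (fun j : Fin k => y' j.succ) ∈ D}
      (fun y' => lam fun j : Fin k => y' j.succ) := hlam.comp_tail
  have h0 : IsSemialgebraicFunOn ℚ {y' : Fin (k + 1) → ℝ | (fun j : Fin k => y' j.succ) ∈ D}
      (fun y' => y' 0) := isSemialgebraicFunOn_apply hT 0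
  have hpos : IsSemialgebraic ℚ {y' : Fin (k + 1) → ℝ | 0 < y' 0} := by
    simpa using Literature.ModelTheory.ExponentialFields.isSemialgebraic_setOf_eval_pos
      (k := ℚ) (R := ℝ) (MvPolynomial.X (0 : Fin (k + 1)))
  have hlt := (h0.fun_sub hlamT).isSemialgebraic_sep_neg
  convert (hT.inter hpos).inter hlt using 1
  ext y'
  simp only [mem_setOf_eq, mem_inter_iff, sub_neg]
  tauto

/-- A semialgebraic function of `D`, read through `tail` on `D⁺`. [cite: BochnakCosteRoy1998, §2.2] -/
theorem isSemialgebraicFunOn_comp_tail_succParam (hD : IsSemialgebraic ℚ D)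
    (hlam : IsSemialgebraicFunOn ℚ D lam) (hF : IsSemialgebraicFunOn ℚ D F) :
    IsSemialgebraicFunOn ℚ {y' : Fin (k + 1) → ℝ | (fun j : Fin k => y' j.succ) ∈ D ∧ 0 < y' 0 ∧
      y' 0 < lam (fun j : Fin k => y' j.succ)} (fun y' => F fun j : Fin k => y' j.succ) :=
  hF.comp_tail.mono (fun _ hy => hy.1) (isSemialgebraic_succParam hD hlam)

/-- `D⁺` is bounded when `D` is bounded and `lam ≤ Λ` on `D`. [folklore] -/
theorem isBounded_succParam {Λ : ℝ} (hDb : Bornology.IsBounded D)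
    (hlamΛ : ∀ y ∈ D, 0 < lam y ∧ lam y ≤ Λ) :
    Bornology.IsBounded {y' : Fin (k + 1) → ℝ | (fun j : Fin k => y' j.succ) ∈ D ∧ 0 < y' 0 ∧
      y' 0 < lam (fun j : Fin k => y' j.succ)} := by
  obtain ⟨C, hC⟩ := hDb.exists_norm_le
  refine isBounded_iff_forall_norm_le.mpr ⟨max C |Λ|, fun y' hy' => ?_⟩
  refine (pi_norm_le_iff_of_nonneg (le_max_of_le_right (abs_nonneg Λ))).mpr fun i => ?_
  refine Fin.cases ?_ (fun j => ?_) i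
  · rw [Real.norm_eq_abs, abs_of_pos hy'.2.1]
    exact le_max_of_le_right ((hy'.2.2.le.trans (hlamΛ _ hy'.1).2).trans (le_abs_self Λ))
  · have h := hC _ hy'.1
    exact le_max_of_le_left ((norm_le_pi_norm (fun j : Fin k => y' j.succ) j).trans h)

/-- Coordinates of points of a bounded set are bounded. [folklore] -/
theorem exists_forall_abs_apply_le {d : ℕ} {S : Set (Fin d → ℝ)} (hS : Bornology.IsBounded S) :
    ∃ R : ℝ, ∀ y ∈ S, ∀ j, |y j| ≤ R := by
  obtain ⟨C, hC⟩ := hS.exists_norm_le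
  exact ⟨C, fun y hy j => (Real.norm_eq_abs (y j)) ▸ (norm_le_pi_norm y j).trans (hC y hy)⟩

/-- A bounded measurable set has finite Lebesgue measure, hence constants are integrable on it. [folklore] -/
theorem integrableOn_const_of_isBounded {d : ℕ} {S : Set (Fin d → ℝ)} (hS : Bornology.IsBounded S)
    (c : ℝ) : IntegrableOn (fun _ : Fin d → ℝ => c) S :=
  integrableOn_const hS.measure_lt_top.ne

end SuccParam

/-! ## The open band over the base -/

section Band

variable {n k : ℕ} {D : Set (Fin k → ℝ)} {F lam : (Fin k → ℝ) → ℝ}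

/-- The OPEN Newton–Leibniz band `{w | init w ∈ base, 0 < w_last < lam(y(init w))}` over the base is
`ℚ`-semialgebraic. [cite: BochnakCosteRoy1998, §2.2] -/
theorem isSemialgebraic_openBand (hD : IsSemialgebraic ℚ D) (hlam : IsSemialgebraicFunOn ℚ D lam) :
    IsSemialgebraic ℚ {w : Fin (n + k + 1) → ℝ |
      (Fin.init w : Fin (n + k) → ℝ) ∈ {z : Fin (n + k) → ℝ | (∀ i : Fin n, z (Fin.castAdd k i) ∈ Ioo (0:ℝ) 1) ∧
        (fun j : Fin k => z (Fin.natAdd n j)) ∈ D} ∧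
      0 < w (Fin.last (n + k)) ∧
      w (Fin.last (n + k)) < lam (fun j : Fin k => (Fin.init w : Fin (n + k) → ℝ) (Fin.natAdd n j))} := by
  have hB := isSemialgebraic_base (n := n) hD
  have hT : IsSemialgebraic ℚ {w : Fin (n + k + 1) → ℝ | (Fin.init w : Fin (n + k) → ℝ) ∈
      {z : Fin (n + k) → ℝ | (∀ i : Fin n, z (Fin.castAdd k i) ∈ Ioo (0:ℝ) 1) ∧
        (fun j : Fin k => z (Fin.natAdd n j)) ∈ D}} := hB.setOf_init_mem
  have hlamT := (isSemialgebraicFunOn_param_base (n := n) hD hlam).comp_init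
  have hlast : IsSemialgebraicFunOn ℚ _ (fun w : Fin (n + k + 1) → ℝ => w (Fin.last (n + k))) :=
    isSemialgebraicFunOn_apply hT _
  have hpos : IsSemialgebraic ℚ {w : Fin (n + k + 1) → ℝ | 0 < w (Fin.last (n + k))} := by
    simpa using Literature.ModelTheory.ExponentialFields.isSemialgebraic_setOf_eval_pos
      (k := ℚ) (R := ℝ) (MvPolynomial.X (Fin.last (n + k)))
  have hlt := (hlast.fun_sub hlamT).isSemialgebraic_sep_neg
  convert (hT.inter hpos).inter hlt using 1
  ext w
  simp only [mem_setOf_eq, mem_inter_iff, sub_neg]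
  tauto

/-- A semialgebraic function of the parameter block, read through `init` on any semialgebraic subset of
the cylinder over the base (e.g. a band). [cite: BochnakCosteRoy1998, §2.2] -/
theorem isSemialgebraicFunOn_param_initBand (hD : IsSemialgebraic ℚ D) (hF : IsSemialgebraicFunOn ℚ D F)
    {B : Set (Fin (n + k + 1) → ℝ)} (hB : IsSemialgebraic ℚ B)
    (hBsub : B ⊆ {w | (Fin.init w : Fin (n + k) → ℝ) ∈ {z : Fin (n + k) → ℝ |
      (∀ i : Fin n, z (Fin.castAdd k i) ∈ Ioo (0:ℝ) 1) ∧ (fun j : Fin k => z (Fin.natAdd n j)) ∈ D}}) :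
    IsSemialgebraicFunOn ℚ B (fun w => F fun j : Fin k => (Fin.init w : Fin (n + k) → ℝ) (Fin.natAdd n j)) :=
  (isSemialgebraicFunOn_param_base (n := n) hD hF).comp_init_mono hB hBsub

end Band

end Summit.KontsevichZagierPeriods.Theorems.HurwitzMicroSectorsHurwitzSectorComplement.LadderEngine

namespace Summit.KontsevichZagierPeriods.Theorems.HurwitzMicroSectorsHurwitzSectorComplement

/-- **Registered sub-goal of `stub_ladderEngine` (semialgebraic layer).** The advanced parameter block
`D⁺ = {y′ ∈ ℝᵏ⁺¹ | tail y′ ∈ D, 0 < y′₀ < lam(tail y′)}` of a ladder step is `ℚ`-semialgebraic whenever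
`D` is and `lam` is a `ℚ`-semialgebraic function on `D`. [cite: BochnakCosteRoy1998, §2.2] -/
theorem ladderEngine_succParam :
    ∀ (k : ℕ) (D : Set (Fin k → ℝ)) (lam : (Fin k → ℝ) → ℝ), Literature.ModelTheory.ExponentialFields.IsSemialgebraic ℚ D → IsSemialgebraicFunOn ℚ D lam → Literature.ModelTheory.ExponentialFields.IsSemialgebraic ℚ {y' : Fin (k + 1) → ℝ | (fun j : Fin k => y' j.succ) ∈ D ∧ 0 < y' 0 ∧ y' 0 < lam (fun j : Fin k => y' j.succ)} :=
  fun _ _ _ hD hlam => LadderEngine.isSemialgebraic_succParam hD hlam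

end Summit.KontsevichZagierPeriods.Theorems.HurwitzMicroSectorsHurwitzSectorComplement

end
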